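/-
Copyright: the b2b-balaban T⁴-continuum CRUX team, row NE7b OWNER lineage `t4-ne7b-p1` (gen 123). Project licence.
-/
import Summits.QuantumFields.BalabanUV.T4Continuum.Spine.NE7b.SupZdPropagatorUniqueness

/-!
# THE INFINITE-VOLUME PROPAGATOR OF THE ROAD'S CLASS IS SYMMETRIC: for every `V : ℤ^d → [−λ, Λ]`, `d ≥ 3`, every mesh, the bounded
# solutions `G(·, q₁)`, `G(·, q₂)` of `H_V u = 𝟙_{q₁}`, `H_V u = 𝟙_{q₂}` on `ℤ^d` (which exist and are unique by (180)∕(181)) satisfy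
# `G(q₂, q₁) = G(q₁, q₂)` — the torus symmetry (133) `action_form_symm` at every level of the tower, read on point sources beyond the window
# radius, passed to the limit, and uniqueness (row NE7b, node U5c; (133)∕(148)∕(152)∕(180)∕(181) BY NAME; [folklore])

Cell `pub-balaban`, sub-cell `t4`, spine estimate NE7b (`T4WeightBudget.RelWeightBound`; the cell's OWN estimate — NOT PRINTED in
[Bałaban 1983–89], NOT PROVED).  Crux-route work under `Spine/NE7b/` by the row OWNER (`t4-ne7b-p1` gen 123, file (183)) under FREEZE
(0)'s crux-prover clause; NOTHING of Bałaban's is named as a Lean object, valued or asserted; no `T4Continuum/Support` leaf typed; no `def`,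
no notation (the `ℤ^d` operator DISPLAYED; `G` is not defined — the statement is about ANY bounded solutions); zero `sorry`.  Imports (BY
NAME): the OWNER's (181) `…SupZdPropagatorUniqueness` (`zd_bounded_solution_unique`; through it (180) `tower_limit`, `inWindow_of_le`, (152)
`supNorm_bound_road`, (148) `action_surjective`, (133) `action_form_symm`, the Literature window kit `Beta.InfiniteVolume`).

WHY (located).  Every duality argument of the torus column ((148) `blockSum_eq_pairing`, (153), (149)) rests on the symmetry of `H` and
hence of `H⁻¹`; the `ℤ^d` column ((180)–(182)) needs the same.  On `T_k`, (133) gives `Σ_x u₁(x)(H u₂)(x) = Σ_x u₂(x)(H u₁)(x)`; for the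
window readings of the point sources `𝟙_{q_i}` and `k` beyond the window radius of `q₁, q₂`, `𝟙_{q_i}∘wm_k = 𝟙_{σ_k q_i}` (`wm_k` is injective
and `wm_k(σ_k q_i) = q_i`), so the identity reads `u₁^{(k)}(σ_k q₂) = u₂^{(k)}(σ_k q₁)`; both sides converge ((180) `tower_limit`) to the
values of the tower limits, which are bounded ((152)) and hence ARE the given bounded solutions ((181)).

WHAT IS PROVED ([folklore]; `X d = ℤ^d`; the `ℤ^d` operator `(H_V u)(p) = (n+1)²Σ_μ(2u p − u(p + ê_μ) − u(p − ê_μ)) + a(n+1)^{−d}Σ_{q ∈ B n (blk n p)}u q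
+ V p·u p` DISPLAYED):
* §1 `pointSource_window_reading` (beyond the window radius of `q`, `𝟙_{q}(wm_k x) = 𝟙[x = σ_k q]`).
* §2 **`zd_propagator_symmetric`**: `d ≥ 3`, `a > 0`, `λ < min(2,a)`, `Λ ≥ 0`, `V : ℤ^d → [−λ, Λ]`, `u₁, u₂` BOUNDED with `H_V u₁ = 𝟙_{q₁}`,
  `H_V u₂ = 𝟙_{q₂}` on `ℤ^d` ⟹ `u₁ q₂ = u₂ q₁`.
* §3 toy (`d = 3`).

HONEST (what this is NOT).  Symmetry of the bounded propagator only (no positivity is claimed — the class `V ≥ −λ` is indefinite at single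
sites); `d ≥ 3` only; the LINEAR column only; scalar skeleton ((A3), NC-NE7b-α UNRULED); nothing of the covariant propagators of [B4]–[B6];
nothing of Bałaban's.  BY-NAME EFFECT ON THE WALL: NONE.  NE7b NOT PRINTED ∕ NOT PROVED; spine PROVED 0∕9; rung (B)+1 — the programme's
measures remain FINITE-torus statements; NOT the mass gap, NOT Clay.  HONEST DEPENDENCY: continuum YM on T⁴ ⇐ BetaPertH ∧ nine spine
estimates (0∕9 proved); BetaPertH ⇐ (D1) ∧ (D4) ∧ CAP+tail; G-an2-4 gates asym, D1 and NE2∕3∕4.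
-/

set_option autoImplicit false

noncomputable section

namespace Summit.QuantumFields.BalabanUV.T4Continuum.NE7b.SupZdPropagatorSymmetry

open Real Filter Topology
open Literature.MathematicalPhysics.QuantumFieldTheory.Balaban1983to89
open B6QGQLower276 (X e blk B side side_facts chart mem_B sum_B sum_B_const card_cube blk_chart)
open Beta (Site siteOf windowMap siteOf_windowMap siteOf_add siteOf_sub InWindow windowMap_siteOf inWindow_windowMap
  inWindow_of_two_mul_abs_lt)
open SupTorusActionForm (action_form_symm)
open SupTorusSupNormBound (action_surjective)
open SupTorusSupNormRoad (supNorm_bound_road)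
open SupZdPropagatorLimit (tower_limit inWindow_of_le)
open SupZdPropagatorUniqueness (zd_bounded_solution_unique)

variable {d : ℕ}

/-! ## §1. Point sources read through the window -/

/-- **BEYOND THE WINDOW RADIUS OF `q`, THE WINDOW READING OF `𝟙_{q}` IS `𝟙_{σ_k q}`**: if `2Σ_i|q i| + 1 ≤ k` then for every site `x` of
`T_k = Site d ((n+1)3^k)`, `(wm_k x = q) ↔ (x = σ_k q)` (`wm_k` is a section of `σ_k`, and `wm_k(σ_k q) = q`). [folklore] -/
theorem pointSource_window_reading (n k : ℕ) (q : X d) (hk : 2 * ∑ i, (q i).natAbs + 1 ≤ k) (x : Site d ((n + 1) * 3 ^ k)) :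
    (if windowMap d ((n + 1) * 3 ^ k) x = q then (1 : ℝ) else 0) = if x = siteOf d ((n + 1) * 3 ^ k) q then 1 else 0 := by
  have hwq : windowMap d ((n + 1) * 3 ^ k) (siteOf d ((n + 1) * 3 ^ k) q) = q :=
    windowMap_siteOf d ((n + 1) * 3 ^ k) (inWindow_of_le n k q hk)
  by_cases hx : x = siteOf d ((n + 1) * 3 ^ k) q
  · rw [if_pos hx, hx, hwq, if_pos rfl]
  · rw [if_neg hx, if_neg]
    intro h
    exact hx (by rw [← siteOf_windowMap d ((n + 1) * 3 ^ k) x, h])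

/-! ## §2. THE END: symmetry of the bounded `ℤ^d` propagator -/

/-- **HEADLINE — `G(q₂, q₁) = G(q₁, q₂)`: BOUNDED SOLUTIONS OF `H_V u₁ = 𝟙_{q₁}`, `H_V u₂ = 𝟙_{q₂}` ON `ℤ^d` SATISFY `u₁ q₂ = u₂ q₁`**, for every
`V : ℤ^d → [−λ, Λ]`, `d ≥ 3`, every mesh: (133) `action_form_symm` at every level of the tower on the window readings of the point sources
(§1), (180) `tower_limit` for both families, boundedness of the limits ((152)) and (181) uniqueness. [folklore] -/
theorem zd_propagator_symmetric (hd : 3 ≤ d) (a : ℝ) (ha : 0 < a) {lam Lam : ℝ} (hlam : lam < min 2 a) (hLam : 0 ≤ Lam)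
    (n : ℕ) (V : X d → ℝ) (hV : ∀ p, -lam ≤ V p) (hV' : ∀ p, V p ≤ Lam) (q₁ q₂ : X d) (u₁ u₂ : X d → ℝ) {B₁ B₂ : ℝ}
    (hu₁B : ∀ p, |u₁ p| ≤ B₁) (hu₂B : ∀ p, |u₂ p| ≤ B₂)
    (hu₁ : ∀ p, ((n : ℝ) + 1) ^ 2 * ∑ μ, (2 * u₁ p - u₁ (p + e μ) - u₁ (p - e μ))
      + a / ((n : ℝ) + 1) ^ d * ∑ q ∈ B n (blk n p), u₁ q + V p * u₁ p = if p = q₁ then 1 else 0)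
    (hu₂ : ∀ p, ((n : ℝ) + 1) ^ 2 * ∑ μ, (2 * u₂ p - u₂ (p + e μ) - u₂ (p - e μ))
      + a / ((n : ℝ) + 1) ^ d * ∑ q ∈ B n (blk n p), u₂ q + V p * u₂ p = if p = q₂ then 1 else 0) :
    u₁ q₂ = u₂ q₁ := by
  classical
  have hm0 : 0 < min 2 a - lam := by linarith
  obtain ⟨C₀, hC₀, H152⟩ := supNorm_bound_road (d := d) hd a ha hlam hLam
  -- the two point sources on `ℤ^d` and their torus solutions along the tower
  set f₁ : X d → ℝ := fun p => if p = q₁ then 1 else 0 with hf₁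
  set f₂ : X d → ℝ := fun p => if p = q₂ then 1 else 0 with hf₂
  have hf₁M : ∀ p, |f₁ p| ≤ 1 := fun p => by simp only [hf₁]; split_ifs <;> simp
  have hf₂M : ∀ p, |f₂ p| ≤ 1 := fun p => by simp only [hf₂]; split_ifs <;> simp
  choose w₁ hw₁ using fun k : ℕ => action_surjective n a (3 ^ k) ha.le hm0 (fun x => V (windowMap d ((n + 1) * 3 ^ k) x))
    (fun x => hV _) (fun x => f₁ (windowMap d ((n + 1) * 3 ^ k) x))
  choose w₂ hw₂ using fun k : ℕ => action_surjective n a (3 ^ k) ha.le hm0 (fun x => V (windowMap d ((n + 1) * 3 ^ k) x))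
    (fun x => hV _) (fun x => f₂ (windowMap d ((n + 1) * 3 ^ k) x))
  obtain ⟨v₁, hv₁eq, hlim₁⟩ := tower_limit hd a ha hlam hLam n V hV hV' f₁ hf₁M w₁ hw₁
  obtain ⟨v₂, hv₂eq, hlim₂⟩ := tower_limit hd a ha hlam hLam n V hV hV' f₂ hf₂M w₂ hw₂
  -- the limits are bounded, hence ARE the given bounded solutions
  have hv₁B : ∀ p, |v₁ p| ≤ C₀ * 1 := fun p =>
    le_of_tendsto (hlim₁ p).abs (Filter.Eventually.of_forall fun k =>
      H152 n (3 ^ k) (fun x => V (windowMap d ((n + 1) * 3 ^ k) x)) (fun x => hV _) (fun x => hV' _) 1 (w₁ k)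
        (fun x => f₁ (windowMap d ((n + 1) * 3 ^ k) x)) (fun x => hf₁M _) (hw₁ k) _)
  have hv₂B : ∀ p, |v₂ p| ≤ C₀ * 1 := fun p =>
    le_of_tendsto (hlim₂ p).abs (Filter.Eventually.of_forall fun k =>
      H152 n (3 ^ k) (fun x => V (windowMap d ((n + 1) * 3 ^ k) x)) (fun x => hV _) (fun x => hV' _) 1 (w₂ k)
        (fun x => f₂ (windowMap d ((n + 1) * 3 ^ k) x)) (fun x => hf₂M _) (hw₂ k) _)
  have hu₁v₁ : u₁ = v₁ := zd_bounded_solution_unique hd a ha hlam hLam n V hV hV' f₁ u₁ v₁ hu₁B hv₁B hu₁ hv₁eq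
  have hu₂v₂ : u₂ = v₂ := zd_bounded_solution_unique hd a ha hlam hLam n V hV hV' f₂ u₂ v₂ hu₂B hv₂B hu₂ hv₂eq
  rw [hu₁v₁, hu₂v₂]
  -- torus symmetry at every level, read on the point sources beyond the window radius of `q₁, q₂`
  set k₀ : ℕ := 2 * ∑ i, (q₁ i).natAbs + 2 * ∑ i, (q₂ i).natAbs + 1 with hk₀
  have hsym : ∀ k, k₀ ≤ k → w₁ k (siteOf d ((n + 1) * 3 ^ k) q₂) = w₂ k (siteOf d ((n + 1) * 3 ^ k) q₁) := by
    intro k hk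
    have hk₁ : 2 * ∑ i, (q₁ i).natAbs + 1 ≤ k := by rw [hk₀] at hk; omega
    have hk₂ : 2 * ∑ i, (q₂ i).natAbs + 1 ≤ k := by rw [hk₀] at hk; omega
    have h := action_form_symm n a (3 ^ k) (fun x => V (windowMap d ((n + 1) * 3 ^ k) x)) (w₁ k) (w₂ k)
    simp only [hw₁ k, hw₂ k, hf₁, hf₂] at h
    simp only [pointSource_window_reading n k q₁ hk₁, pointSource_window_reading n k q₂ hk₂, mul_ite, mul_one, mul_zero,
      Finset.sum_ite_eq', Finset.mem_univ, if_true] at h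
    exact h.symm
  have hev : (fun k => w₂ k (siteOf d ((n + 1) * 3 ^ k) q₁)) =ᶠ[atTop] (fun k => w₁ k (siteOf d ((n + 1) * 3 ^ k) q₂)) :=
    Filter.eventually_atTop.2 ⟨k₀, fun k hk => (hsym k hk).symm⟩
  exact tendsto_nhds_unique (hlim₁ q₂) ((hlim₂ q₁).congr' hev)

/-! ## §3. Toy -/

/-- Toy (`d = 3`, `n = 0`, `k = 1`): the window reading of the point source at the origin is the torus point source at `σ 0`. -/
example (x : Site 3 ((0 + 1) * 3 ^ 1)) :
    (if windowMap 3 ((0 + 1) * 3 ^ 1) x = 0 then (1 : ℝ) else 0) = if x = siteOf 3 ((0 + 1) * 3 ^ 1) 0 then 1 else 0 :=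
  pointSource_window_reading 0 1 0 (by simp) x

end Summit.QuantumFields.BalabanUV.T4Continuum.NE7b.SupZdPropagatorSymmetry
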